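import Summits.CriticalPhenomena.PercolationContinuityZ3.Theorems.PercNearOneGluingNoHeavyConstsThreePointSKProof
import HarnessLib

/-!
# The three-point DIAMOND inequality on every finite weighted graph, by concavity along EVERY edge

Support file for crux `stmt-CriticalPhenomena-4575` (`NoHeavyLowerTail`), seat `prim-l12-p1` gen 22 (`--supports stmt-CriticalPhenomena-4575`);
memo `run/shared/lean/prim/prim-l12/FROM-prim-l12-p1-g22-DIAMOND-ALL-GRAPHS.md`.
**THEOREM (`diamond_all`; the programme's open conjecture `Consts.ThreePointDiamond`, prim-consts-2 gen 18 — the sign half of Gladkov's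
Conjecture 10.1 for Bernoulli percolation on finite graphs).**  For bond percolation `μ = prodBernoulli w` with arbitrary pair weights on a finite
vertex type and any vertices `a, b, c`, in the five-type notation of `…ConstsThreePointSKOneEdge` (`S` = all separate, `K` = all joined,
`J_a` = "`a` alone" `= {a↮b, a↮c, b↔c}`):
    `μ(J_a) · μ(J_b) ≤ μ(S) · μ(K)`,   i.e.  `P(bc|a)·P(ac|b) ≤ P(a|b|c)·P(abc)`.
(van den Berg–Kahn Thm 1.2 gives only `μ(J_a)μ(J_b) ≤ μ(K)·(μ(S) + μ(J_c))`, `Consts.threePoint_vdBK`.)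

PROOF — the SK3 template of prim-consts-1 gen 14 (`…ConstsThreePointSKProof`), with a different margin.  Along the weight `t` of ANY pair `e`
the five type probabilities are affine, and opening one edge moves the type only along `S → J_x → K`
(`Consts.SK3.real_S_sub/real_K_sub/real_J_sub`: `s₁ − s₀ = −Σα`, `k₁ − k₀ = Σβ`, `j_{x,1} − j_{x,0} = α_x − β_x`, `α, β ≥ 0`).  Hence the
DIAMOND margin `D(t) = s k − j_a j_b` satisfies the exact identity (`diamond_interpolate`)
    `D(t) = (1−t)·D(0) + t·D(1) + t(1−t)·[α_aβ_a + α_bβ_b + (α_a + α_b)β_c + α_c(β_a + β_b + β_c) + α_aα_b + β_aβ_b]`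
— **the diamond margin is CONCAVE along every edge weight** — so `D(0), D(1) ≥ 0 ⟹ D(t) ≥ 0`; induction on the number of weights outside
`{0,1}`; the frozen base case is a deterministic configuration where `J_a ∩ J_b = ∅` kills the product (`Consts.SK3.real_mul_real_eq_zero_of_frozen`).
A second proof (port pairs only, sure-component induction, explicit cell identities) is `…ThreePointDiamondUniversal`.
No definitions, no sorries, standard axioms; no correlation inequality is used.
-/

noncomputable section

namespace Summit.CriticalPhenomena.PercolationContinuityZ3.Theorems.ThreePointDiamondAnyEdge

open MeasureTheory Set Literature.Probability.LatticeModels Literature.Probability.Percolation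
open Summit.CriticalPhenomena.PercolationContinuityZ3.Theorems.Consts.SK3
open scoped Classical

variable {V : Type*}

/-- Notation (this file only): `𝐉[a, b, c]` = "`a` alone" (`a ↮ b`, `a ↮ c`, `b ⟷ c`). -/
local notation3 "𝐉[" a ", " b ", " c "]" =>
  ((openConn a b)ᶜ ∩ (openConn a c)ᶜ ∩ openConn b c : Set (BondConfig _))

/-- Notation (this file only): `𝐒[a, b, c]` = "all three separated". -/
local notation3 "𝐒[" a ", " b ", " c "]" =>
  ((openConn a b)ᶜ ∩ (openConn a c)ᶜ ∩ (openConn b c)ᶜ : Set (BondConfig _))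

/-- Notation (this file only): `𝐊[a, b, c]` = "all three joined". -/
local notation3 "𝐊[" a ", " b ", " c "]" =>
  (openConn a b ∩ openConn a c ∩ openConn b c : Set (BondConfig _))

/-- Notation (this file only): `𝐏[e] A` = the configurations `ω` with `ω ∪ {e} ∈ A`. -/
local notation3 "𝐏[" e "] " A:max => ({ω | insert e ω ∈ A} : Set (BondConfig _))

/-! ### The algebra of one interpolation step: the diamond margin is concave along every edge -/

/-- **Concavity of the diamond margin along one edge weight.**  If `s, k, p = j_a, q = j_b` are affine in `t ∈ [0,1]` with the one-edge
transition structure `s₀ − s₁ = α_p + α_q + α_r`, `k₁ − k₀ = β_p + β_q + β_r`, `p₁ − p₀ = α_p − β_p`, `q₁ − q₀ = α_q − β_q` (`α, β ≥ 0`) and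
`p q ≤ s k` at `t = 0` and `t = 1`, then `p q ≤ s k` at `t`:
`D(t) = (1−t)D(0) + tD(1) + t(1−t)·[α_pβ_p + α_pβ_r + α_qβ_q + α_qβ_r + α_r(β_p+β_q+β_r) + α_pα_q + β_pβ_q]`. [this work] -/
theorem diamond_interpolate (t s₀ s₁ k₀ k₁ p₀ p₁ q₀ q₁ αp αq αr βp βq βr : ℝ)
    (ht0 : 0 ≤ t) (ht1 : t ≤ 1)
    (hs : s₀ - s₁ = αp + αq + αr) (hk : k₁ - k₀ = βp + βq + βr)
    (hp : p₁ - p₀ = αp - βp) (hq : q₁ - q₀ = αq - βq)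
    (hαp : 0 ≤ αp) (hαq : 0 ≤ αq) (hαr : 0 ≤ αr) (hβp : 0 ≤ βp) (hβq : 0 ≤ βq) (hβr : 0 ≤ βr)
    (h0 : p₀ * q₀ ≤ s₀ * k₀) (h1 : p₁ * q₁ ≤ s₁ * k₁) :
    ((1 - t) * p₀ + t * p₁) * ((1 - t) * q₀ + t * q₁) ≤ ((1 - t) * s₀ + t * s₁) * ((1 - t) * k₀ + t * k₁) := by
  have es : s₁ = s₀ - (αp + αq + αr) := by linarith
  have ek : k₁ = k₀ + (βp + βq + βr) := by linarith
  have ep : p₁ = p₀ + (αp - βp) := by linarith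
  have eq : q₁ = q₀ + (αq - βq) := by linarith
  have key : ((1 - t) * s₀ + t * s₁) * ((1 - t) * k₀ + t * k₁) - ((1 - t) * p₀ + t * p₁) * ((1 - t) * q₀ + t * q₁) =
      (1 - t) * (s₀ * k₀ - p₀ * q₀) + t * (s₁ * k₁ - p₁ * q₁) +
        t * (1 - t) * (αp * βp + αp * βr + αq * βq + αq * βr + αr * (βp + βq + βr) + αp * αq + βp * βq) := by
    rw [es, ek, ep, eq]; ring
  have hC : 0 ≤ t * (1 - t) * (αp * βp + αp * βr + αq * βq + αq * βr + αr * (βp + βq + βr) + αp * αq + βp * βq) :=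
    mul_nonneg (mul_nonneg ht0 (sub_nonneg.2 ht1)) (by positivity)
  have hA := mul_nonneg (sub_nonneg.2 ht1) (sub_nonneg.2 h0)
  have hB := mul_nonneg ht0 (sub_nonneg.2 h1)
  linarith [key, hC, hA, hB]

/-! ### The diamond inequality -/

variable [Fintype V]

/-- **THE THREE-POINT DIAMOND INEQUALITY (every finite weighted graph, every three vertices):**
`μ(a alone)·μ(b alone) ≤ μ(a|b|c)·μ(abc)`, i.e. `P(bc|a)·P(ac|b) ≤ P(a|b|c)·P(abc)`.  Induction on the number of weights outside `{0,1}`;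
one step = concavity of the margin in one edge weight (`diamond_interpolate` with the transition identities of
`…ConstsThreePointSKOneEdge`). [this work] -/
theorem diamond_all (w : Sym2 V → unitInterval) (a b c : V) :
    (prodBernoulli w).real 𝐉[a, b, c] * (prodBernoulli w).real 𝐉[b, a, c] ≤
      (prodBernoulli w).real 𝐒[a, b, c] * (prodBernoulli w).real 𝐊[a, b, c] := by
  classical
  suffices H : ∀ (N : ℕ) (w : Sym2 V → unitInterval),
      ((Finset.univ : Finset (Sym2 V)).filter (fun e => w e ≠ 0 ∧ w e ≠ 1)).card = N →
        (prodBernoulli w).real 𝐉[a, b, c] * (prodBernoulli w).real 𝐉[b, a, c] ≤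
          (prodBernoulli w).real 𝐒[a, b, c] * (prodBernoulli w).real 𝐊[a, b, c] from H _ w rfl
  intro N
  induction N using Nat.strong_induction_on with
  | _ N ih =>
  intro w hN
  by_cases hact : ∃ e : Sym2 V, w e ≠ 0 ∧ w e ≠ 1
  · -- INDUCTIVE STEP: interpolate along `e`
    obtain ⟨e, he0, he1⟩ := hact
    set w₀ : Sym2 V → unitInterval := Function.update w e 0 with hw₀
    set w₁ : Sym2 V → unitInterval := Function.update w e 1 with hw₁
    have hmem : e ∈ (Finset.univ : Finset (Sym2 V)).filter (fun d => w d ≠ 0 ∧ w d ≠ 1) :=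
      Finset.mem_filter.2 ⟨Finset.mem_univ _, he0, he1⟩
    have hcard : ∀ (c : unitInterval), (c = 0 ∨ c = 1) →
        ((Finset.univ : Finset (Sym2 V)).filter (fun d => Function.update w e c d ≠ 0 ∧
          Function.update w e c d ≠ 1)).card < N := by
      intro c hc
      have hsub : (Finset.univ : Finset (Sym2 V)).filter
            (fun d => Function.update w e c d ≠ 0 ∧ Function.update w e c d ≠ 1) ⊆
          ((Finset.univ : Finset (Sym2 V)).filter (fun d => w d ≠ 0 ∧ w d ≠ 1)).erase e := by
        intro d hd
        rw [Finset.mem_filter] at hd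
        have hde : d ≠ e := by
          rintro rfl
          rw [Function.update_self] at hd
          rcases hc with hc | hc
          · exact hd.2.1 hc
          · exact hd.2.2 hc
        rw [Function.update_of_ne hde] at hd
        exact Finset.mem_erase.2 ⟨hde, Finset.mem_filter.2 ⟨Finset.mem_univ _, hd.2⟩⟩
      rw [← hN]
      exact lt_of_le_of_lt (Finset.card_le_card hsub) (Finset.card_erase_lt_of_mem hmem)
    have ih₀ := ih _ (hcard 0 (Or.inl rfl)) w₀ rfl
    have ih₁ := ih _ (hcard 1 (Or.inr rfl)) w₁ rfl
    set μ₀ := prodBernoulli w₀ with hμ₀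
    have hone : ∀ A : Set (BondConfig V), (prodBernoulli w₁).real A = μ₀.real (𝐏[e] A) := fun A =>
      real_update_one_eq_real_preimage w e A
    rw [hone, hone, hone, hone] at ih₁
    have hint : ∀ A : Set (BondConfig V), (prodBernoulli w).real A =
        (1 - (w e : ℝ)) * μ₀.real A + (w e : ℝ) * μ₀.real (𝐏[e] A) := fun A => real_eq_interpolate w e A
    rw [hint, hint, hint, hint]
    have ht0 : 0 ≤ (w e : ℝ) := (w e).2.1
    have ht1 : (w e : ℝ) ≤ 1 := (w e).2.2
    -- transition identities (with `𝐒[b,a,c] = 𝐒[a,b,c]`, `𝐊[b,a,c] = 𝐊[a,b,c]`)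
    have hS := real_S_sub μ₀ e a b c
    have hK := real_K_sub μ₀ e a b c
    have hJa := real_J_sub μ₀ e a b c
    have hJb := real_J_sub μ₀ e b a c
    have eSb : (𝐒[b, a, c] : Set (BondConfig V)) = 𝐒[a, b, c] := by
      ext ω; simp only [mem_inter_iff, mem_compl_iff, openConn, mem_setOf_eq]
      constructor
      · rintro ⟨⟨h1, h2⟩, h3⟩; exact ⟨⟨fun h => h1 h.symm, h3⟩, h2⟩
      · rintro ⟨⟨h1, h2⟩, h3⟩; exact ⟨⟨fun h => h1 h.symm, h3⟩, h2⟩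
    have eKb : (𝐊[b, a, c] : Set (BondConfig V)) = 𝐊[a, b, c] := by
      ext ω; simp only [mem_inter_iff, openConn, mem_setOf_eq]
      constructor
      · rintro ⟨⟨h1, h2⟩, h3⟩; exact ⟨⟨h1.symm, h3⟩, h2⟩
      · rintro ⟨⟨h1, h2⟩, h3⟩; exact ⟨⟨h1.symm, h3⟩, h2⟩
    rw [eSb, eKb] at hJb
    exact diamond_interpolate (w e : ℝ) _ _ _ _ _ _ _ _ _ _ _ _ _ _ ht0 ht1 hS hK hJa hJb
      measureReal_nonneg measureReal_nonneg measureReal_nonneg measureReal_nonneg measureReal_nonneg measureReal_nonneg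
      ih₀ ih₁
  · -- BASE: all weights frozen
    push Not at hact
    have hw : ∀ d, w d = 0 ∨ w d = 1 := by
      intro d
      by_cases h : w d = 0
      · exact Or.inl h
      · exact Or.inr (hact d h)
    have d1 : Disjoint (𝐉[a, b, c] : Set (BondConfig V)) 𝐉[b, a, c] := by
      rw [disjoint_left]; rintro ω h1 h2
      simp only [mem_inter_iff, mem_compl_iff, openConn, mem_setOf_eq] at h1 h2
      exact h1.1.2 h2.2
    rw [real_mul_real_eq_zero_of_frozen w hw d1]
    exact mul_nonneg measureReal_nonneg measureReal_nonneg

/-- **The diamond inequality in cell form**: `μ(a↔c, b↮c)·μ(b↔c, a↮c) ≤ μ(a↔c, b↔c)·μ(a↮b, a↮c, b↮c)` (the spelling of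
`Consts.ThreePointDiamond` up to `openConn x y = openConn y x`; the events `{a↔c, b↮c}` and "`b` alone" coincide, etc.). [this work] -/
theorem diamond_cells (w : Sym2 V → unitInterval) (a b c : V) :
    (prodBernoulli w).real (openConn a c ∩ (openConn b c)ᶜ) * (prodBernoulli w).real (openConn b c ∩ (openConn a c)ᶜ) ≤
      (prodBernoulli w).real (openConn a c ∩ openConn b c) *
        (prodBernoulli w).real ((openConn a b)ᶜ ∩ (openConn a c)ᶜ ∩ (openConn b c)ᶜ) := by
  have h := diamond_all w a b c
  have eT : (openConn a c ∩ (openConn b c)ᶜ : Set (BondConfig V)) = 𝐉[b, a, c] := by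
    ext ω; simp only [mem_inter_iff, mem_compl_iff, openConn, mem_setOf_eq]
    constructor
    · rintro ⟨hac, nbc⟩; exact ⟨⟨fun hba => nbc (hba.trans hac), nbc⟩, hac⟩
    · rintro ⟨⟨-, nbc⟩, hac⟩; exact ⟨hac, nbc⟩
  have eU : (openConn b c ∩ (openConn a c)ᶜ : Set (BondConfig V)) = 𝐉[a, b, c] := by
    ext ω; simp only [mem_inter_iff, mem_compl_iff, openConn, mem_setOf_eq]
    constructor
    · rintro ⟨hbc, nac⟩; exact ⟨⟨fun hab => nac (hab.trans hbc), nac⟩, hbc⟩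
    · rintro ⟨⟨-, nac⟩, hbc⟩; exact ⟨hbc, nac⟩
  have eX : (openConn a c ∩ openConn b c : Set (BondConfig V)) = 𝐊[a, b, c] := by
    ext ω; simp only [mem_inter_iff, openConn, mem_setOf_eq]
    constructor
    · rintro ⟨hac, hbc⟩; exact ⟨⟨hac.trans hbc.symm, hac⟩, hbc⟩
    · rintro ⟨⟨-, hac⟩, hbc⟩; exact ⟨hac, hbc⟩
  rw [eT, eU, eX, mul_comm ((prodBernoulli w).real 𝐉[b, a, c]), mul_comm ((prodBernoulli w).real 𝐊[a, b, c])]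
  exact h

end Summit.CriticalPhenomena.PercolationContinuityZ3.Theorems.ThreePointDiamondAnyEdge

end
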